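import Summits.FinalStateConjecture.FinalStateConjecture.Theorems.SeamedChartsExhaust.Negative.ExactSchwarzschildClauses
import Literature.Geometry.Lorentzian.KerrRegionIINullIncompleteness

/-!
# The re-typed (T2) consequent of `ChannelsResolveTameDevelopmentsR` at the `N = 1` paradigm:
# its spacetime-level clauses hold in the exact Schwarzschild model, and the null-ray clause (C)
# has the intended content on the sub-extremal Kerr chart
# (census for crux `stmt-FinalStateConjecture-17430`, route `PhotonSphereChannels`)

The consequent of the crux (the summit's conclusion after the re-type T2 of 2026-08-16) asks for a
region `O` and a `C²` final-state decomposition `d` with (sub-extremal holes), the shape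
`O = J⁺(Σ) ∩ I⁻(d.charted)` (`exteriorOf`), `RaysStayInClosure 𝒟 O` (C), `HasExhaustiveCharts d`
(F2 with honest radii) and `IsFutureOriented d` (B). The refuter's crux attack certified these clauses
at `N = 0` only. Here, for the exact Schwarzschild model `SchwModel` of the tree
(`SeamedChartsExhaust/Negative/ExactSchwarzschildModel.lean`: the Kerr–Schild patch `{r > r₀}`,
`0 < r₀ ≤ 2M`, `O = {r > 2M}`, ONE identity hole chart, identity flat chart on
`{x⁰ > −1, r > R₀ + 1 + √x⁰}`):

* `SchwModelT2.isFutureOriented_decomp` — clause (B) holds with a hole: the trivial motion is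
  orthochronous, the push-forward of the Kerr–Schild field `V = −g♯(dt*)` under the identity hole chart
  is the time orientation itself, and `dΦ(∂₀) = ∂₀` is future causal on `{r > 2M}` — for ALL chart
  times, not only eventually;
* `SchwModelT2.t2SpacetimeClauses_decomp` / `SchwModelT2.exists_N_one_t2SpacetimeClauses` — on the exterior patch
  (`r₀ = 2M`) all four spacetime-level conjuncts of the T2 consequent hold simultaneously with `N = 1`:
  sub-extremality, the shape `O = J⁺(univ) ∩ I⁻(d.charted)`, `HasExhaustiveCharts d` (honest radii
  `R = R₀ + 4 + √·`, `SchwModel.hasExhaustiveCharts_decomp`) and `IsFutureOriented d`;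
* `Kerr.subset_closure_exterior` / `Kerr.completeNullRay_mem_closure_exterior` — the `N = 1` content of
  clause (C) on the sub-extremal Kerr chart `{r > r₋}` (Boyer–Lindquist blocks I ∪ II, the region of
  the maximal development of Kerr data): a future-directed null geodesic defined on a whole parameter
  ray stays in the CLOSURE of the domain of outer communications `{r > r₊}` — the tree's
  `Kerr.rPlus_le_radius_of_isGeodesicOn_Ioi` (O'Neill 1995, §4.3) combined with
  `{r ≥ r₊} ⊆ closure {r > r₊}` (the Kerr–Schild radius has non-vanishing gradient).

So the T2 clauses are satisfiable with a hole and (C) reads as intended at the paradigm; what no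
model in the tree can exercise is `IsMaximal` (the model is a `Spacetime`, not a certified MGHD of
one-ended admissible data — exact Schwarzschild data are two-ended).

References: B. O'Neill, *The geometry of Kerr black holes*, A K Peters 1995, Ch. 2, §2.5 and Ch. 4,
§4.2–§4.3; M. Dafermos, I. Rodnianski, arXiv:0811.0354, §5.1 (`∇t*` timelike, Kerr–Schild coordinates);
B. O'Neill, *Semi-Riemannian geometry*, Academic Press 1983, Ch. 5, p. 145; M. Dafermos, J. Luk,
arXiv:1710.01722, Conjecture 1.
-/

noncomputable section

open TopologicalSpace Manifold Filter Topology Set Function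
open scoped ContDiff Topology ENNReal Manifold RealInnerProductSpace

-- instance search through nested operator types `E4 →L E4 →L E4 →L ℝ` (as in the tree files)
set_option maxSynthPendingDepth 3
-- `Summit.FinalStateConjecture.FinalStateConjecture.…` (summit = sub-problem) is the tree's layout
set_option linter.dupNamespace false

namespace Summit.FinalStateConjecture.FinalStateConjecture.Theorems.ChannelsResolveTameDevelopmentsR.Negative

open Literature.Geometry.Lorentzian LorentzianMetric
open SeamedChartsExhaust.Negative

/-! ### Clause (B) `IsFutureOriented` and sub-extremality in the exact Schwarzschild model -/

namespace SchwModelT2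

open SchwModel

variable (P : SchwModel.Params)

/-- The trivial Lorentz transformation is orthochronous: `(1 e₀)⁰ = 1 > 0`. O'Neill 1983, Ch. 9,
p. 233. [folklore] -/
theorem isOrthochronous_one : IsOrthochronous (1 : lorentzGroup) := by
  show (0 : ℝ) < (((1 : lorentzGroup) : E4 ≃L[ℝ] E4) (E4.basisVector 0)) 0
  rw [motion_e0]
  simp

/-- The holes of the model are sub-extremal: `|0| < M`. [folklore] -/
theorem isSubextremal_decomp (i : Fin (decomp P).N) :
    Kerr.IsSubextremal ((decomp P).mass i) ((decomp P).spin i) := by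
  show |(0 : ℝ)| < P.M
  rw [abs_zero]; exact P.hM

/-- **Clause (B) of the T2 consequent holds in the exact Schwarzschild model** (`N = 1`): the motion
`(1, 0)` is orthochronous; under the identity hole chart the push-forward of the boosted background's
future field `1 · V_{M,0}(1⁻¹(x − 0)) = V_{M,0}(x)`, `V = −g♯(dt*)`, is the orienting field of the patch
itself, hence future-directed causal at EVERY point of every truncated slab; under the identity flat
chart `dΦ(∂₀) = ∂₀`, future-directed causal on `{r > 2M} ⊇ U` (`g(∂₀, ∂₀) = −1 + 2M/r`,
`g(V, ∂₀) = −1`). Dafermos–Rodnianski arXiv:0811.0354, §5.1; O'Neill 1983, Ch. 5, p. 145.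
[cite: arXiv08110354, §5.1] -/
theorem isFutureOriented_decomp : IsFutureOriented (decomp P) := by
  refine ⟨fun _ ↦ isOrthochronous_one, fun i ρ ↦ Eventually.of_forall fun τ x _ ↦ ?_,
    Eventually.of_forall fun τ y _ ↦ ?_⟩
  · -- the hole chart: `dΨ(V) = V` is the orientation field at `Ψ x`
    show (ST P).timeOrientation.IsFutureDirected (mfderiv 𝓘(ℝ, E4) (𝓡 4) (Ψ P) x
      (((1 : lorentzGroup) : E4 ≃L[ℝ] E4) (Kerr.timeVector P.M 0 (poincareInv 1 0 (x : E4)))))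
    have h1 : (((1 : lorentzGroup) : E4 ≃L[ℝ] E4) (Kerr.timeVector P.M 0 (poincareInv 1 0 (x : E4))))
        = Kerr.timeVector P.M 0 (x : E4) := by
      rw [poincareInv_one_zero]; rfl
    rw [h1]
    exact (congrArg (fun w : E4 ↦ (ST P).timeOrientation.IsFutureDirected (x := Ψ P x) w)
      (OpensChart.mfderiv_inclusion_apply (hbext P) x (Kerr.timeVector P.M 0 (x : E4)))).mpr
        ((ST P).timeOrientation.isFutureDirected_vectorField (Ψ P x))
  · -- the flat chart: `dΦ(∂₀) = ∂₀` is future causal on `{r > 2M}`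
    show (ST P).timeOrientation.IsFutureDirected (mfderiv 𝓘(ℝ, E4) (𝓡 4) (Φ P) y (E4.basisVector 0))
    have hrad : 2 * P.M < Kerr.radius 0 (Φ P y).1 := Φ_mem_O P y
    exact (congrArg (fun w : E4 ↦ (ST P).timeOrientation.IsFutureDirected (x := Φ P y) w)
      (OpensChart.mfderiv_inclusion_apply (hUreg P) y (E4.basisVector 0))).mpr
        (Schw.isFutureDirected_e0 (hM := P.hM.le) (Φ P y) hrad)

/-- **All four spacetime-level conjuncts of the T2 consequent hold simultaneously in the exact
Schwarzschild model on the exterior patch** (`r₀ = 2M`, so that `O = {r > 2M}` is the whole patch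
and has the shape `J⁺(univ) ∩ I⁻(d.charted)` of `exteriorOf`): sub-extremal holes, the `O`-shape,
honest exhaustive charts (`SchwModel.hasExhaustiveCharts_decomp`, radii `R₀ + 4 + √·`) and future
orientation. Dafermos–Rodnianski arXiv:0811.0354, §5.1; Dafermos–Luk arXiv:1710.01722, Conj. 1.
[cite: arXiv08110354, §5.1] -/
theorem t2SpacetimeClauses_decomp (h : P.r₀ = 2 * P.M) :
    (∀ i, Kerr.IsSubextremal ((decomp P).mass i) ((decomp P).spin i)) ∧
      O P = (ST P).metric.causalFuture (ST P).timeOrientation univ ∩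
        (ST P).metric.chronologicalPast (ST P).timeOrientation (decomp P).charted ∧
      HasExhaustiveCharts (decomp P) ∧ IsFutureOriented (decomp P) :=
  ⟨isSubextremal_decomp P, O_eq_core P h, hasExhaustiveCharts_decomp P, isFutureOriented_decomp P⟩

/-- **The spacetime-level clauses of the T2 consequent are satisfiable WITH a hole**: there are a
spacetime `𝓢`, a region `O` and a `C²` final-state decomposition `d` of `O` with exactly one hole
such that every hole is sub-extremal, `O = J⁺(univ) ∩ I⁻(d.charted)`, `HasExhaustiveCharts d` and
`IsFutureOriented d` (the exact Schwarzschild exterior `{r > 2M}`, `M = 1`). Complements the `N = 0`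
satisfiability recorded by the crux attack on stmt-17430; `RaysStayInClosure` and `IsMaximal` need a
Cauchy development and are not exercised here. Dafermos–Rodnianski arXiv:0811.0354, §5.1.
[cite: arXiv08110354, §5.1] -/
theorem exists_N_one_t2SpacetimeClauses :
    ∃ (𝓢 : Spacetime.{0} 4) (O : Set 𝓢.carrier) (d : FinalStateDecomposition 𝓢 O 2),
      d.N = 1 ∧ (∀ i, Kerr.IsSubextremal (d.mass i) (d.spin i)) ∧
        O = 𝓢.metric.causalFuture 𝓢.timeOrientation univ ∩
          𝓢.metric.chronologicalPast 𝓢.timeOrientation d.charted ∧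
        HasExhaustiveCharts d ∧ IsFutureOriented d :=
  -- unit-mass parameters of the exterior patch: `M = 1`, `r₀ = 2 = 2M`, `R₀ = 100`
  let P₂ : SchwModel.Params := ⟨1, 2, 100, one_pos, two_pos, by norm_num, by norm_num⟩
  ⟨ST P₂, O P₂, decomp P₂, rfl, t2SpacetimeClauses_decomp P₂ (by show (2 : ℝ) = 2 * 1; norm_num)⟩

end SchwModelT2

/-! ### Clause (C) at `N = 1`: complete null rays of the Kerr chart stay in the closure of `{r > r₊}` -/

namespace Kerr

open Literature.Geometry.Lorentzian.Kerr

/-- In a Kerr–Schild patch `{r > max r₀ 0}` the super-level set `{r ≥ c}` lies in the closure of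
`{r > c}`: at a point with `r = c` the Kerr–Schild radius has the non-zero gradient `∇_E r`
(`|∇_E r|² = (r² + a²)/Σ > 0`), so `r` increases to first order along the straight line in the
direction `(0, ∇_E r)`. Visser arXiv:0706.0622, (35). [cite: arXiv07060622, (35)] -/
theorem subset_closure_exterior (a r₀ c : ℝ) :
    {x : Kerr.region a r₀ | c ≤ Kerr.radius a (x : E4)} ⊆
      closure {x : Kerr.region a r₀ | c < Kerr.radius a (x : E4)} := by
  intro x hx
  rcases (show c ≤ Kerr.radius a (x : E4) from hx).lt_or_eq with hlt | heq
  · exact subset_closure hlt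
  -- `r(x) = c`: approach `x` along `λ ↦ x + λ (0, ∇_E r)` from `λ > 0`
  have hxr : 0 < Kerr.radius a (x : E4) := Kerr.radius_pos_of_mem_region x.2
  set w : E4 := E4.ofTimeSpace 0 (Kerr.radiusGradVec a (E4.spatial (x : E4))) with hw
  set f : ℝ → ℝ := fun t ↦ Kerr.radius a ((x : E4) + t • w) with hf
  -- derivative of `r` along the line at `0` is `|∇_E r|² > 0`
  have hline : HasDerivAt (fun t : ℝ ↦ (x : E4) + t • w) w 0 := by
    simpa using ((hasDerivAt_id (0 : ℝ)).smul_const w).const_add (x : E4)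
  have hder : HasDerivAt f (Kerr.radiusGrad a (E4.spatial (x : E4)) (E4.spatial w)) 0 := by
    have := (Kerr.hasFDerivAt_radius hxr).comp_hasDerivAt_of_eq (x := (0 : ℝ)) hline (by simp)
    simpa [hf, Function.comp_def] using this
  have hxr' : 0 < Kerr.radius a (E4.ofTimeSpace 0 (E4.spatial (x : E4))) := by
    rwa [Kerr.radius_ofTimeSpace_spatial]
  have hDpos : 0 < Kerr.radiusGrad a (E4.spatial (x : E4)) (E4.spatial w) := by
    rw [hw, E4.spatial_ofTimeSpace, Kerr.radiusGrad_apply, Kerr.inner_radiusGradVec_self hxr']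
    exact div_pos (by positivity) (Kerr.blSigma_pos hxr')
  -- hence `f t > f 0 = c` for small `t > 0`
  have hev : ∀ᶠ t in 𝓝[>] (0 : ℝ), c < f t := by
    have h1 := hder.tendsto_slope_zero_right.eventually (lt_mem_nhds hDpos)
    have h2 : ∀ᶠ t in 𝓝[>] (0 : ℝ), 0 < t := self_mem_nhdsWithin
    filter_upwards [h1, h2] with t ht ht0
    have hf0 : f 0 = c := by simp [hf, heq]
    rw [zero_add, smul_eq_mul] at ht
    have : 0 < f t - f 0 := by
      by_contra hle
      push Not at hle
      have : t⁻¹ * (f t - f 0) ≤ 0 := mul_nonpos_of_nonneg_of_nonpos (inv_pos.2 ht0).le hle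
      linarith
    linarith
  -- and these points lie in the patch
  have hreg : ∀ᶠ t in 𝓝[>] (0 : ℝ), (x : E4) + t • w ∈ Kerr.region a r₀ := by
    filter_upwards [hev] with t ht
    have hx2 : max r₀ 0 < Kerr.radius a (x : E4) := x.2
    show max r₀ 0 < Kerr.radius a ((x : E4) + t • w)
    rw [← heq] at hx2
    exact hx2.trans ht
  -- closure in the (open) subtype = preimage of the closure of the image
  rw [Topology.IsInducing.subtypeVal.closure_eq_preimage_closure_image, mem_preimage]
  have htend : Tendsto (fun t : ℝ ↦ (x : E4) + t • w) (𝓝[>] 0) (𝓝 (x : E4)) := by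
    have hc : Continuous fun t : ℝ ↦ (x : E4) + t • w := by fun_prop
    simpa using (hc.tendsto 0).mono_left nhdsWithin_le_nhds
  refine mem_closure_of_tendsto htend ?_
  filter_upwards [hev, hreg] with t ht htr
  exact ⟨⟨(x : E4) + t • w, htr⟩, ht, rfl⟩

/-- **Clause (C) at the paradigm `N = 1`.** In the ingoing Kerr–Schild chart
`Kerr.spacetime M a r₋ hM = ({r > r₋}, g_{M,a}, −g♯dt*)` of a sub-extremal Kerr black hole
(`|a| < M`) — Boyer–Lindquist blocks I ∪ II, the region of the maximal development of Kerr data — a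
geodesic defined on a whole parameter ray `(t₀, ∞)` which is null and future-directed at some
`t₁ > t₀` lies at `t₁` in the CLOSURE of the domain of outer communications `{r > r₊}` (and hence at
every parameter of the ray, `completeNullRay_subset_closure_exterior`): null geodesics entering the
black hole `{r < r₊}` reach `{r = r₋}` at finite affine parameter
(`Kerr.rPlus_le_radius_of_isGeodesicOn_Ioi`), and `{r ≥ r₊} ⊆ closure {r > r₊}`
(`subset_closure_exterior`). This is the content the T2 clause `RaysStayInClosure 𝒟 O`,
`O = J⁺(Σ) ∩ I⁻(charts) =` the future domain of outer communications, has at a single Kerr black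
hole. O'Neill 1995, Ch. 2, §2.5 and Ch. 4, §4.2–§4.3; Hawking–Ellis 1973, §5.6.
[cite: ONeill1995, Ch. 4, §4.2–§4.3] -/
theorem completeNullRay_mem_closure_exterior [Kerr.Facts] {M a : ℝ} (h : |a| < M) (hM : 0 ≤ M)
    [(Kerr.spacetime M a (Kerr.rMinus M a) hM).metric.HasLeviCivita]
    {γ : ℝ → Kerr.region a (Kerr.rMinus M a)} {t₀ t₁ : ℝ} (ht₀₁ : t₀ < t₁)
    (hγ : IsGeodesicOn (Kerr.spacetime M a (Kerr.rMinus M a) hM).metric.leviCivita γ (Ioi t₀))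
    (hN : (Kerr.spacetime M a (Kerr.rMinus M a) hM).metric.IsNull (velocity 𝓘(ℝ, E4) γ t₁))
    (hF : (Kerr.spacetime M a (Kerr.rMinus M a) hM).timeOrientation.IsFutureDirected
      (velocity 𝓘(ℝ, E4) γ t₁)) :
    γ t₁ ∈ closure {x : Kerr.region a (Kerr.rMinus M a) | Kerr.rPlus M a < Kerr.radius a (x : E4)} :=
  subset_closure_exterior a (Kerr.rMinus M a) (Kerr.rPlus M a)
    (Kerr.rPlus_le_radius_of_isGeodesicOn_Ioi h hM ht₀₁ hγ hN hF)

/-- **The whole ray stays in the closure of the exterior**: under the hypotheses of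
`completeNullRay_mem_closure_exterior`, `γ t ∈ closure {r > r₊}` for EVERY `t > t₀` — nullness and
future-directedness of the velocity propagate along the geodesic
(`IsGeodesicOn.isNull_and_isFutureDirected_velocity`), so the previous statement applies at each
parameter. In the vocabulary of the T2 clause: on the Kerr chart a future-directed null geodesic with
parameter domain unbounded above never visits the complement of `closure {r > r₊}`.
O'Neill 1995, Ch. 4, §4.2–§4.3. [cite: ONeill1995, Ch. 4, §4.2–§4.3] -/
theorem completeNullRay_subset_closure_exterior [Kerr.Facts] {M a : ℝ} (h : |a| < M) (hM : 0 ≤ M)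
    [(Kerr.spacetime M a (Kerr.rMinus M a) hM).metric.HasLeviCivita]
    {γ : ℝ → Kerr.region a (Kerr.rMinus M a)} {t₀ t₁ : ℝ} (ht₀₁ : t₀ < t₁)
    (hγ : IsGeodesicOn (Kerr.spacetime M a (Kerr.rMinus M a) hM).metric.leviCivita γ (Ioi t₀))
    (hN : (Kerr.spacetime M a (Kerr.rMinus M a) hM).metric.IsNull (velocity 𝓘(ℝ, E4) γ t₁))
    (hF : (Kerr.spacetime M a (Kerr.rMinus M a) hM).timeOrientation.IsFutureDirected
      (velocity 𝓘(ℝ, E4) γ t₁)) :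
    ∀ t ∈ Ioi t₀, γ t ∈
      closure {x : Kerr.region a (Kerr.rMinus M a) | Kerr.rPlus M a < Kerr.radius a (x : E4)} := by
  intro t ht
  set 𝓚 := Kerr.spacetime M a (Kerr.rMinus M a) hM with h𝓚
  -- smoothness of the Levi-Civita connection, for the propagation lemma (as in the tree proof of
  -- `Kerr.rPlus_le_radius_of_isGeodesicOn_Ioi`)
  haveI : Fact ((1 : ℕ∞ω) ≤ ((⊤ : ℕ∞) : WithTop ℕ∞)) := ⟨by exact_mod_cast le_top⟩
  haveI : CovariantDerivative.ContMDiffCovariantDerivative 𝓚.metric.leviCivita 1 :=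
    ⟨𝓚.metric.toPseudoRiemannianMetric.isLocallyContMDiff_leviCivita_holds 1
      (by rw [show ((1 : ℕ∞) : ℕ∞ω) + 1 = 2 by norm_num]; exact WithTop.coe_le_coe.2 le_top)
      univ isOpen_univ⟩
  have hNF := hγ.isNull_and_isFutureDirected_velocity 𝓚.metric 𝓚.timeOrientation isOpen_Ioi
    Set.ordConnected_Ioi ht₀₁ hN hF ht
  exact completeNullRay_mem_closure_exterior h hM ht hγ hNF.1 hNF.2

end Kerr

end Summit.FinalStateConjecture.FinalStateConjecture.Theorems.ChannelsResolveTameDevelopmentsR.Negative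

end
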